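import Mathlib
import Literature.Combinatorics.Additive.TripleProductProperty
import Summits.MatrixMultiplication.MatrixMultiplication.Theses.SnSubsetDichotomy
import Summits.MatrixMultiplication.MatrixMultiplication.Theorems.SnSubsetDichotomyThresholdSubsetTriplesStubCayleyDeletion
import Summits.MatrixMultiplication.MatrixMultiplication.Theorems.SnSubsetDichotomyThresholdSubsetTriplesStubTwistFreeOfBlocked
import Summits.MatrixMultiplication.MatrixMultiplication.Theorems.SnSubsetDichotomyThresholdSubsetTriplesStubTppOfTwistFree
import Summits.MatrixMultiplication.MatrixMultiplication.Theorems.SnSubsetDichotomyThresholdSubsetTriplesStubCubeThreshold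

/-!
# Crux `SnSubsetDichotomy.ThresholdSubsetTriples` (stmt-MatrixMultiplication-10882) — line `SketchIdeator2`
(ℤ/3-triality), lead skeleton

The line: a threshold TPP subset triple of `S_n` is sought in the ℤ/3-symmetric form
`(X, τXτ⁻¹, τ²Xτ⁻²)` with `τ³ = 1`.  For such triples the six-variable TPP condition is the
ONE-SET twisted corner condition "`x₁x₁'⁻¹ τ x₂x₂'⁻¹ τ x₃x₃'⁻¹ τ = 1` only trivially"
(`stub_tpp_of_twistFree`, cards `cyclotomic-triality` / `triality-uniquely-cubing-translate`,
Lean-certified to be the same lever by the triagers' `Merge.lean`).  Designs are produced the way the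
only non-Young data point was produced (n = 10, volume `0.0041·(10!)^{3/2}`): take a HOST `K` all of
whose non-trivial twisted corners are BLOCKED by a small set `B` of bad quotients
(`stub_blockedHosts`, the open design stub, held by the lead), delete greedily to a sub-code `X ⊆ K`
avoiding `B` as a quotient with `|K| ≤ (2|B|+1)|X|` (`stub_cayleyDeletion`), observe that `X` is
twisted-corner-free (`stub_twistFree_of_blocked`), hence `(X, X^τ, X^{τ²})` is a TPP triple of volume
`|X|³ > (√(n!)·e^{-(c/3)√n})³ = (n!)^{3/2} e^{-c√n}` (`stub_cubeThreshold`).  The composition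
`ThresholdSubsetTriples_of` closes the crux modulo the stubs.

Status (lead, cycle 1): `stub_cayleyDeletion` (p85947), `stub_twistFree_of_blocked` (p85948),
`stub_tpp_of_twistFree` (p85977), `stub_cubeThreshold` (p86006) LANDED under `Theorems/` and are imported;
the only `sorry` left is the design `stub_blockedHosts`.
Lead c2-0 (2026-08-17, re-seat after `triality-uniquely-cubing-translate` died): skeleton re-registered unchanged; 1 open stub
`stub_blockedHosts` (siege k3/k7/k9/k13/k23/k24 + Disproof §8a: ⟺ `C⁺ = TrialityThreshold` at the same scale), wave none.
Lead c3-0 (2026-08-17, continuation): skeleton unchanged; `stub_blockedHosts` ⟺ `C⁺` by the tree theorem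
`symmetricThreshold_iff_blockedHosts` (p140745); wave = the two registered by-product stubs `twistFree_iff_tpp`,
`tpp_conj_iff_corner` (triality lever as an equivalence, general group).
-/

namespace Summit.MatrixMultiplication.MatrixMultiplication.Theorems.ThresholdSubsetTriples

open Literature.Combinatorics.Additive
open Summit.MatrixMultiplication.MatrixMultiplication.Theses.SnSubsetDichotomy

/-- **Stub `stub_blockedHosts` (OPEN — the design; lead).**  For every `c > 0`, cofinally in `n`:
an element `τ` of `S_n` with `τ³ = 1`, a host `K ⊆ S_n` and a blocking set `B ⊆ S_n` such that every
solution of the twisted corner equation `x₁x₁'⁻¹ τ (x₂x₂'⁻¹) τ (x₃x₃'⁻¹) τ = 1` with all six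
variables in `K` is either trivial (`xᵢ = xᵢ'`) or has a non-trivial quotient `xᵢxᵢ'⁻¹` in `B`, and
`|K| > (2|B|+1)·√(n!)·e^{-c√n}`.  (The `n = 10` witness of card `cyclotomic-triality` is
`K = Aut(M) ∩ Stab(1)`, `|K| = 384`, `|B| = 1`.) -/
theorem stub_blockedHosts : ∀ c : ℝ, 0 < c → ∀ n₀ : ℕ, ∃ n ≥ n₀, ∃ τ : Equiv.Perm (Fin n), τ ^ 3 = 1 ∧ ∃ K B : Finset (Equiv.Perm (Fin n)), (∀ x₁ ∈ K, ∀ x₁' ∈ K, ∀ x₂ ∈ K, ∀ x₂' ∈ K, ∀ x₃ ∈ K, ∀ x₃' ∈ K, x₁ * x₁'⁻¹ * τ * (x₂ * x₂'⁻¹) * τ * (x₃ * x₃'⁻¹) * τ = 1 → (x₁ = x₁' ∧ x₂ = x₂' ∧ x₃ = x₃') ∨ (x₁ * x₁'⁻¹ ∈ B ∧ x₁ ≠ x₁') ∨ (x₂ * x₂'⁻¹ ∈ B ∧ x₂ ≠ x₂') ∨ (x₃ * x₃'⁻¹ ∈ B ∧ x₃ ≠ x₃')) ∧ ((2 * B.card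 + 1 : ℕ) : ℝ) * (Real.sqrt (n.factorial : ℝ) * Real.exp (-(c * Real.sqrt (n : ℝ)))) < (K.card : ℝ) := by
  sorry

/-- Conjugation by `τ` is injective. -/
theorem conj_injective {G : Type*} [Group G] (τ : G) :
    Function.Injective (fun x : G => τ * x * τ⁻¹) := by
  intro a b h
  simpa using h

/-- **Composition.**  The stubs close the crux: blocked host ⟶ Cayley deletion ⟶ twisted-corner-free
sub-code ⟶ TPP triple `(X, X^τ, X^{τ²})` ⟶ volume `|X|³ > (n!)^{3/2}e^{-c√n}`. -/
theorem ThresholdSubsetTriples_of : ThresholdSubsetTriples := by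
  intro c hc n₀
  obtain ⟨n, hn, τ, hτ, K, B, hBl, hbig⟩ := stub_blockedHosts (c / 3) (by positivity) n₀
  obtain ⟨X, hXK, hA, hcard⟩ := stub_cayleyDeletion n K B
  refine ⟨n, hn, X, X.image (fun x => τ * x * τ⁻¹), X.image (fun x => τ ^ 2 * x * (τ ^ 2)⁻¹),
    stub_tpp_of_twistFree n τ X hτ (stub_twistFree_of_blocked n τ K B X hXK hBl hA), ?_⟩
  rw [Finset.card_image_of_injective _ (conj_injective _),
    Finset.card_image_of_injective _ (conj_injective _)]
  apply stub_cubeThreshold c n X.card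
  have hpos : (0 : ℝ) < ((2 * B.card + 1 : ℕ) : ℝ) := by positivity
  have hKX : (K.card : ℝ) ≤ ((2 * B.card + 1 : ℕ) : ℝ) * (X.card : ℝ) := by exact_mod_cast hcard
  have h := lt_of_lt_of_le hbig hKX
  exact lt_of_mul_lt_mul_left h hpos.le

end Summit.MatrixMultiplication.MatrixMultiplication.Theorems.ThresholdSubsetTriples
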